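import Summits.ValiantsHypothesis.ValiantsHypothesis.Theorems.NNDivisionHard.Negative.WeakReliefBlindBigCore
import Summits.ValiantsHypothesis.ValiantsHypothesis.Theorems.NNDivisionHard.Negative.WeakReliefBlindSmallClass

/-!
# The weak-relief blindness identity, part 5b (§5 packaging): ★★★ `inv_rankPlus_le` — the untilted located-permutahedron pencil `(1 − |a∩b|)² + λ·inv(a;π)` is BLIND for EVERY integer `λ ≥ 1`

PORT NOTE (staged by the AUTHOR val-idea-39 g4 for the Negative-lane port pool — val-port-3 g3 pressed parts 1–4; critic of record val-idea-crit-9 g2, V#85 booked CLAIM D′ as KEEP ★★ paper+computation, kernel = this §5): texts VERBATIM BY NAME from the crux workfile `Cruxes/NNDivisionHard/WeakReliefBlind39.lean` rev 6 @80a90c42bbb7 (sha16 07dd5d64bc8c71fd; farm rc 0 / 0 sorries / 0 warnings); the ONLY changes are the namespace (= parts 1–4), the 400-line-cap SPLIT (5a/5b), one-line docstrings on helper lemmas (gate lint), and — as in part 4 — the `inv` split inside `bigInv_identity` is re-derived from part 2's `invInd_split` (so no import of part 3b).  VP ≠ VNP is NOT proved; the crux `NNDivisionHard` stays OPEN; `LocatedPencilLaw`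 is refuted in the kernel by ✓ p679540 — these files are INDEPENDENT Negative-lane identities.  This part imports part 5a (`big_core`) and part 4 (`cSmall`, `smallInv_rankPlus_le`).

§5 (author's docstring, verbatim).  The LARGE column classes `|P ∩ b| ≥ 2` — and the full untilted theorem for every `λ ≥ 1`

For `|a| = |P|` and a column `b` meeting `P` in `q = |P ∩ b| ≥ 2` points, the unit weak relief `(1 − |a∩b|)² + |a∖P|` has the
explicit six-family certificate (`s = |a∩P∩b|`, `u = |(P∖a)∩b|`, `v = |(a∖P)∩b|`, `d = |a∖P| = |P∖a|`, `q = s + u`)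
`2q(q−1)·((1−|a∩b|)² + |a∖P|) = q(q−1) + u(u−1) + 2(q−1)[(d−v)u + s(d−u)] + 2q(q−1)v(v−1) + 2(q−1)(2q−1)vs + (2(q−1)²−1)s(s−1)`,
every term an ordered-pair family (row factor `(1−X_l)(1−X_{l′})`, `X_l(1−X_{l′})` or `X_lX_{l′}` ≥ 0; column factor a product of
`P`/`b` indicators with a coefficient that is ≥ 0 once `q ≥ 2`).  With §4 (`q ≤ 1`) and the bubble-sort split of the inversion count this gives
`inv_rankPlus_le`: `(1 − |a∩b|)² + λ·inv(a;π)` is blind for EVERY integer `λ ≥ 1`, on all rows and all columns, untilted (O(n³) slots).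
The certificate was found by an LP over relabeling-covariant pairwise families and verified exactly for `n ≤ 7` before typing.
-/

-- the mandated summit-side namespace repeats a component by design (single-problem summit)
set_option linter.dupNamespace false

namespace Summit.ValiantsHypothesis.Theorems.NNDivisionHardNegative.WeakReliefBlind

open Finset
open Summit.ValiantsHypothesis.Theorems.NNDivisionHardNegative.BlindCubeIdentity
  (ind ind_nonneg ind_le_one ind_mul_self ind_inter sum_ind sum_ind_mul sum_ite_eq_sub)

section BigClass
variable {n : ℕ}

/-- the two column classes partition: `[q ≤ 1] + [q ≥ 2] = 1` -/
theorem cSmall_add_cTwo (b P : Finset (Fin n)) : cSmall b P + cTwo b P = 1 := by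
  unfold cSmall cTwo
  split_ifs <;> first | rfl | omega

/-! ### the large-class permutahedral identity and its packaging -/

/-- index of the large-class certificate inside one size class: constant, 6 pair families, recourse `E`, boundary -/
abbrev BIdx (n : ℕ) := Unit ⊕ (Fin 6 × (Fin n × Fin n)) ⊕ (Fin n × Fin n) ⊕ (Fin n × Fin n)

/-- row factors (≥ 0 for `λ ≥ 1`) -/
def bigRowI (lam : ℤ) (a : Finset (Fin n)) : BIdx n → ℤ
  | Sum.inl _ => 1
  | Sum.inr (Sum.inl (j, (l, l'))) => bigRow a j l l'
  | Sum.inr (Sum.inr (Sum.inl (l, l'))) => lam * (ind a l * (1 - ind a l'))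
  | Sum.inr (Sum.inr (Sum.inr (l, l₂))) => ind a l * ind a l₂ * (lam - (if l = l₂ then 1 else 0))

/-- integer column factors at size class `k` (`P = P_k(π)`, `q = |P ∩ b|`, everything carries `[q ≥ 2]`; ≥ 0) -/
def bigColI (b : Finset (Fin n)) (π : Equiv.Perm (Fin n)) (k : ℕ) : BIdx n → ℤ
  | Sum.inl _ => cTwo b (posLT π k) * ((((posLT π k ∩ b).card : ℤ)) * ((((posLT π k ∩ b).card : ℤ)) - 1))
  | Sum.inr (Sum.inl (j, (l, l'))) => cTwo b (posLT π k) * bigCol (((posLT π k ∩ b).card : ℤ)) b (posLT π k) j l l'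
  | Sum.inr (Sum.inr (Sum.inl (l, l'))) =>
      cTwo b (posLT π k) * (2 * (((posLT π k ∩ b).card : ℤ)) * ((((posLT π k ∩ b).card : ℤ)) - 1)) *
        (((1 - pInd π k l) * (1 - pInd π k l') + pInd π k l * pInd π k l') * invInd π l l')
  | Sum.inr (Sum.inr (Sum.inr (l, l₂))) =>
      cTwo b (posLT π k) * (2 * (((posLT π k ∩ b).card : ℤ)) * ((((posLT π k ∩ b).card : ℤ)) - 1)) *
        ((1 - pInd π k l) * (1 - pInd π k l₂))

/-- packaged row factors are ≥ 0 once `λ ≥ 1` -/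
theorem bigRowI_nonneg {lam : ℤ} {a : Finset (Fin n)} (hlam : 1 ≤ lam) (s) : 0 ≤ bigRowI lam a s := by
  have h0 := ind_nonneg a; have h1 := ind_le_one a
  rcases s with u | ⟨j, l, l'⟩ | ⟨l, l'⟩ | ⟨l, l₂⟩ <;> simp only [bigRowI]
  · norm_num
  · exact bigRow_nonneg a j l l'
  · exact mul_nonneg (by linarith) (mul_nonneg (h0 l) (by linarith [h1 l']))
  · refine mul_nonneg (mul_nonneg (h0 l) (h0 l₂)) ?_
    split_ifs <;> linarith

/-- `2q(q−1) ≥ 0` for the natural number `q = |P∩b|` -/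
theorem twoqq_nonneg (b P : Finset (Fin n)) : (0 : ℤ) ≤ 2 * ((P ∩ b).card : ℤ) * (((P ∩ b).card : ℤ) - 1) := by
  rcases Nat.eq_zero_or_pos (P ∩ b).card with h | h
  · simp [h]
  · have h1 : (1 : ℤ) ≤ ((P ∩ b).card : ℤ) := by exact_mod_cast h
    exact mul_nonneg (mul_nonneg (by norm_num) (by linarith)) (by linarith)

/-- packaged integer column factors are ≥ 0 -/
theorem bigColI_nonneg (b : Finset (Fin n)) (π : Equiv.Perm (Fin n)) (k : ℕ) (s) : 0 ≤ bigColI b π k s := by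
  have h0 := pInd_nonneg π k; have h1 := pInd_le_one π k
  have hc := cTwo_nonneg' b (posLT π k)
  have hqq := twoqq_nonneg b (posLT π k)
  rcases s with u | ⟨j, l, l'⟩ | ⟨l, l'⟩ | ⟨l, l₂⟩ <;> simp only [bigColI]
  · refine mul_nonneg hc ?_
    rcases Nat.eq_zero_or_pos (posLT π k ∩ b).card with h | h
    · simp [h]
    · have h1' : (1 : ℤ) ≤ ((posLT π k ∩ b).card : ℤ) := by exact_mod_cast h
      exact mul_nonneg (by linarith) (by linarith)
  · exact bigCol_w_nonneg b (posLT π k) j l l'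
  · refine mul_nonneg (mul_nonneg hc hqq) (mul_nonneg ?_ (invInd_nonneg π l l'))
    nlinarith [h0 l, h1 l, h0 l', h1 l', mul_nonneg (h0 l) (h0 l'),
      mul_nonneg (by linarith [h1 l] : (0:ℤ) ≤ 1 - pInd π k l) (by linarith [h1 l'] : (0:ℤ) ≤ 1 - pInd π k l')]
  · exact mul_nonneg (mul_nonneg hc hqq) (mul_nonneg (by linarith [h1 l]) (by linarith [h1 l₂]))

/-- ★★ **THE LARGE-CLASS PERMUTAHEDRAL IDENTITY** (all `n`, all `λ`, every row `a` and column `(b, π)`; `P = P_{|a|}(π)`, `q = |P∩b|`):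
`[q ≥ 2]·2q(q−1)·((1 − |a∩b|)² + λ·inv(a;π)) = [q ≥ 2]·(q(q−1) + Σ six pair families)`   (`big_core` at the unit weak relief)
` + [q ≥ 2]·2q(q−1)·Σ_{l,l′} λX_l(1−X_{l′})·([l,l′ ∉ P] + [l,l′ ∈ P])[π(l′)<π(l)]`   (inversions inside `Pᶜ×Pᶜ` and `P×P`)
` + [q ≥ 2]·2q(q−1)·Σ_{l,l₂} X_lX_{l₂}(λ − [l=l₂])·[l ∉ P][l₂ ∉ P]`   (`λd² − d`). -/
theorem bigInv_identity (lam : ℤ) (a b : Finset (Fin n)) (π : Equiv.Perm (Fin n)) :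
    cTwo b (posLT π a.card) * (2 * (((posLT π a.card ∩ b).card : ℤ)) * ((((posLT π a.card ∩ b).card : ℤ)) - 1)) *
        ((1 - ((a ∩ b).card : ℤ)) ^ 2 + lam * inv a π) =
      (cTwo b (posLT π a.card) * ((((posLT π a.card ∩ b).card : ℤ)) * ((((posLT π a.card ∩ b).card : ℤ)) - 1)) +
        ∑ j : Fin 6, ∑ l, ∑ l', bigRow a j l l' *
          (cTwo b (posLT π a.card) * bigCol (((posLT π a.card ∩ b).card : ℤ)) b (posLT π a.card) j l l')) +
      ((∑ l, ∑ l', (lam * (ind a l * (1 - ind a l'))) *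
          (cTwo b (posLT π a.card) * (2 * (((posLT π a.card ∩ b).card : ℤ)) * ((((posLT π a.card ∩ b).card : ℤ)) - 1)) *
            ((((1 - pInd π a.card l) * (1 - pInd π a.card l') + pInd π a.card l * pInd π a.card l') * invInd π l l')))) +
       (∑ l, ∑ l₂, (ind a l * ind a l₂ * (lam - (if l = l₂ then 1 else 0))) *
          (cTwo b (posLT π a.card) * (2 * (((posLT π a.card ∩ b).card : ℤ)) * ((((posLT π a.card ∩ b).card : ℤ)) - 1)) *
            ((1 - pInd π a.card l) * (1 - pInd π a.card l₂))))) := by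
  classical
  set P := posLT π a.card with hPdef
  set q : ℤ := ((P ∩ b).card : ℤ) with hqdef
  set w : ℤ := cTwo b P with hw
  have hkn : a.card ≤ n := by simpa using Finset.card_le_univ a
  have hPk : P.card = a.card := by rw [hPdef]; exact card_posLT π hkn
  have hX2 := ind_mul_self a
  have hP2 := pInd_mul_self π a.card
  have hPi : ∀ l, ind P l = pInd π a.card l := fun l => by rw [hPdef]; exact ind_posLT π a.card l
  have core := big_core_w w q a b P hPk hqdef
  -- (1) the recourse splits along `P`
  have hinv : inv a π = (∑ l, ind a l * (1 - pInd π a.card l)) * (∑ l, (1 - ind a l) * pInd π a.card l) +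
      ∑ l, ∑ l', ind a l * (1 - ind a l') *
        (((1 - pInd π a.card l) * (1 - pInd π a.card l') + pInd π a.card l * pInd π a.card l') * invInd π l l') := by
    unfold inv
    rw [Finset.sum_mul_sum, ← Finset.sum_add_distrib]
    refine Finset.sum_congr rfl fun l _ => ?_
    rw [← Finset.sum_add_distrib]
    refine Finset.sum_congr rfl fun l' _ => ?_
    conv_lhs => rw [invInd_split π a.card l l']
    ring
  -- (2) the boundary family is `W·(λ x² − x)`, `x = Σ X_l (1 − Π_l)`, `W = w·2q(q−1)`
  set W : ℤ := w * (2 * q * (q - 1)) with hW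
  have hbd : ∑ l, ∑ l₂, (ind a l * ind a l₂ * (lam - (if l = l₂ then 1 else 0))) *
        (W * ((1 - pInd π a.card l) * (1 - pInd π a.card l₂))) =
      W * (lam * (∑ l, ind a l * (1 - pInd π a.card l)) ^ 2 - ∑ l, ind a l * (1 - pInd π a.card l)) := by
    have e : ∀ l l₂, (ind a l * ind a l₂ * (lam - (if l = l₂ then 1 else 0))) *
        (W * ((1 - pInd π a.card l) * (1 - pInd π a.card l₂))) =
        W * (lam * ((ind a l * (1 - pInd π a.card l)) * (ind a l₂ * (1 - pInd π a.card l₂)))) -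
          W * (if l = l₂ then (ind a l * (1 - pInd π a.card l)) * (ind a l₂ * (1 - pInd π a.card l₂)) else 0) := by
      intro l l₂; split_ifs <;> ring
    have idem : ∀ l, (ind a l * (1 - pInd π a.card l)) * (ind a l * (1 - pInd π a.card l)) = ind a l * (1 - pInd π a.card l) := by
      intro l
      linear_combination ((1 - pInd π a.card l) * (1 - pInd π a.card l)) * hX2 l + ind a l * hP2 l
    have inner : ∀ l, ∑ l₂, (ind a l * ind a l₂ * (lam - (if l = l₂ then 1 else 0))) *
        (W * ((1 - pInd π a.card l) * (1 - pInd π a.card l₂))) =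
        W * (lam * ((ind a l * (1 - pInd π a.card l)) * ∑ l₂, ind a l₂ * (1 - pInd π a.card l₂))) -
          W * (ind a l * (1 - pInd π a.card l)) := by
      intro l
      rw [Finset.sum_congr rfl (fun l₂ _ => e l l₂), Finset.sum_sub_distrib, ← Finset.mul_sum, ← Finset.mul_sum,
        ← Finset.mul_sum, ← Finset.mul_sum, Finset.sum_ite_eq]
      simp only [Finset.mem_univ, if_true]
      rw [idem l]
    rw [Finset.sum_congr rfl (fun l _ => inner l), Finset.sum_sub_distrib, ← Finset.mul_sum, ← Finset.mul_sum,
      ← Finset.mul_sum, ← Finset.sum_mul, sq]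
    ring
  have hE : ∑ l, ∑ l', (lam * (ind a l * (1 - ind a l'))) *
        (W * ((((1 - pInd π a.card l) * (1 - pInd π a.card l') + pInd π a.card l * pInd π a.card l') * invInd π l l'))) =
      W * (lam * ∑ l, ∑ l', ind a l * (1 - ind a l') *
        (((1 - pInd π a.card l) * (1 - pInd π a.card l') + pInd π a.card l * pInd π a.card l') * invInd π l l')) := by
    rw [Finset.mul_sum, Finset.mul_sum]
    refine Finset.sum_congr rfl fun l _ => ?_
    rw [Finset.mul_sum, Finset.mul_sum]
    exact Finset.sum_congr rfl fun l' _ => by ring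
  rw [hinv, hbd, hE]
  -- (3) bookkeeping: x = |a| − |a∩P| = y, then `core`
  have sX := sum_ind a
  have sXP : ∑ l, ind a l * pInd π a.card l = ((a ∩ P).card : ℤ) := by
    simp_rw [← hPi]; exact sum_ind_mul a _
  have sP : ∑ l, pInd π a.card l = (P.card : ℤ) := by
    simp_rw [← hPi]; exact sum_ind _
  have hx : ∑ l, ind a l * (1 - pInd π a.card l) = (a.card : ℤ) - ((a ∩ P).card : ℤ) := by
    rw [← sX, ← sXP, ← Finset.sum_sub_distrib]
    exact Finset.sum_congr rfl fun l _ => by ring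
  have hy : ∑ l', (1 - ind a l') * pInd π a.card l' = (P.card : ℤ) - ((a ∩ P).card : ℤ) := by
    rw [← sP, ← sXP, ← Finset.sum_sub_distrib]
    exact Finset.sum_congr rfl fun l _ => by ring
  rw [hx, hy, hPk]
  linear_combination core

/-- the identity in packaged form for ONE row -/
theorem bigInv_identity' (lam : ℤ) (a b : Finset (Fin n)) (π : Equiv.Perm (Fin n)) :
    cTwo b (posLT π a.card) * (2 * (((posLT π a.card ∩ b).card : ℤ)) * ((((posLT π a.card ∩ b).card : ℤ)) - 1)) *
        ((1 - ((a ∩ b).card : ℤ)) ^ 2 + lam * inv a π) =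
      ∑ s, bigRowI lam a s * bigColI b π a.card s := by
  rw [bigInv_identity lam a b π]
  simp only [Fintype.sum_sum_type, Fintype.sum_prod_type, bigRowI, bigColI, Finset.sum_const, Finset.card_univ,
    Fintype.card_unit, one_smul, one_mul]
  ac_rfl

/-- index of the large-class certificate: one block per size class -/
abbrev BIdxK (n : ℕ) := Fin (n + 1) × BIdx n

/-- ★★ **`rank₊([|P_{|a|}(π) ∩ b| ≥ 2]·((1 − |a∩b|)² + λ·inv(a;π))) ≤ (n+1)·|BIdx n|` for every `n` and every integer `λ ≥ 1`.** -/
theorem bigInv_rankPlus_le (n : ℕ) (lam : ℤ) (hlam : 1 ≤ lam) :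
    ∃ (U : Finset (Fin n) → BIdxK n → ℝ) (V : Finset (Fin n) × Equiv.Perm (Fin n) → BIdxK n → ℝ),
      (∀ a s, 0 ≤ U a s) ∧ (∀ bπ s, 0 ≤ V bπ s) ∧
      ∀ (a b : Finset (Fin n)) (π : Equiv.Perm (Fin n)),
        (cTwo b (posLT π a.card) : ℝ) * (((1 : ℝ) - ((a ∩ b).card : ℝ)) ^ 2 + (lam : ℝ) * (inv a π : ℝ)) =
          ∑ s, U a s * V (b, π) s := by
  classical
  refine ⟨fun a s => if (s.1 : ℕ) = a.card then (bigRowI lam a s.2 : ℝ) else 0,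
    fun bπ s => (bigColI bπ.1 bπ.2 (s.1 : ℕ) s.2 : ℝ) /
      (2 * (((posLT bπ.2 (s.1 : ℕ) ∩ bπ.1).card : ℝ)) * ((((posLT bπ.2 (s.1 : ℕ) ∩ bπ.1).card : ℝ)) - 1)), ?_, ?_, ?_⟩
  · intro a s
    dsimp only
    split_ifs
    · exact_mod_cast bigRowI_nonneg hlam s.2
    · exact le_rfl
  · intro bπ s
    dsimp only
    refine div_nonneg (by exact_mod_cast bigColI_nonneg bπ.1 bπ.2 _ s.2) ?_
    exact_mod_cast twoqq_nonneg bπ.1 (posLT bπ.2 (s.1 : ℕ))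
  · intro a b π
    have hkn : a.card < n + 1 := by
      have : a.card ≤ n := by simpa using Finset.card_le_univ a
      omega
    -- the integer identity, cast to ℝ
    have h := congrArg (fun z : ℤ => (z : ℝ)) (bigInv_identity' lam a b π)
    simp only [Int.cast_add, Int.cast_pow, Int.cast_sub, Int.cast_one, Int.cast_mul, Int.cast_natCast, Int.cast_sum,
      Int.cast_ofNat] at h
    rw [Fintype.sum_prod_type, Finset.sum_eq_single (⟨a.card, hkn⟩ : Fin (n + 1))]
    · simp only [if_true]
      set D : ℝ := 2 * (((posLT π a.card ∩ b).card : ℝ)) * ((((posLT π a.card ∩ b).card : ℝ)) - 1) with hD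
      rcases cTwo_cases b (posLT π a.card) with h0 | h1
      · -- class `q ≤ 1`: both sides vanish
        have hV : ∀ s, (bigColI b π a.card s : ℝ) = 0 := by
          intro s
          rcases s with u | ⟨j, l, l'⟩ | ⟨l, l'⟩ | ⟨l, l₂⟩ <;> simp [bigColI, h0]
        simp [h0, hV]
      · have hq := two_le_of_cTwo b (posLT π a.card) h1
        have hDpos : 0 < D := by
          have hq' : (2 : ℝ) ≤ ((posLT π a.card ∩ b).card : ℝ) := by exact_mod_cast hq
          rw [hD]; nlinarith
        have key : (cTwo b (posLT π a.card) : ℝ) * (((1 : ℝ) - ((a ∩ b).card : ℝ)) ^ 2 + (lam : ℝ) * (inv a π : ℝ)) =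
            (∑ s, (bigRowI lam a s : ℝ) * (bigColI b π a.card s : ℝ)) / D := by
          rw [eq_div_iff hDpos.ne', ← h, hD]; ring
        rw [key, Finset.sum_div]
        exact Finset.sum_congr rfl fun s _ => by rw [mul_div_assoc]
    · intro k _ hk
      have : (k : ℕ) ≠ a.card := fun e => hk (Fin.ext e)
      simp [this]
    · intro h'; exact absurd (Finset.mem_univ _) h'

/-- ★★★ **THE UNTILTED PERMUTAHEDRAL PENCIL IS BLIND FOR EVERY `λ ≥ 1`:**
`rank₊((1 − |a∩b|)² + λ·inv(a;π)) ≤ (n+1)·(|WIdx n| + 2n² + |BIdx n|) = O(n³)` for every `n` and every integer `λ ≥ 1` — nonnegative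
`U`, `V` with `(1 − |a∩b|)² + λ·inv(a;π) = Σ_s U a s · V (b,π) s` for ALL rows `a ⊆ [n]` and ALL columns `(b, π)`.
(§4 handles the columns with `|P_{|a|}(π) ∩ b| ≤ 1`, `bigInv_rankPlus_le` the others; `[q ≤ 1] + [q ≥ 2] = 1`.)
This supersedes §2 (`λ ≥ n+1`): the untilted small-λ residue is empty for integer `λ`. -/
theorem inv_rankPlus_le (n : ℕ) (lam : ℤ) (hlam : 1 ≤ lam) :
    ∃ (U : Finset (Fin n) → PIdx n ⊕ BIdxK n → ℝ) (V : Finset (Fin n) × Equiv.Perm (Fin n) → PIdx n ⊕ BIdxK n → ℝ),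
      (∀ a s, 0 ≤ U a s) ∧ (∀ bπ s, 0 ≤ V bπ s) ∧
      ∀ (a b : Finset (Fin n)) (π : Equiv.Perm (Fin n)),
        ((1 : ℝ) - ((a ∩ b).card : ℝ)) ^ 2 + (lam : ℝ) * (inv a π : ℝ) = ∑ s, U a s * V (b, π) s := by
  obtain ⟨U₁, V₁, hU₁, hV₁, h₁⟩ := smallInv_rankPlus_le n lam hlam
  obtain ⟨U₂, V₂, hU₂, hV₂, h₂⟩ := bigInv_rankPlus_le n lam hlam
  refine ⟨fun a s => Sum.elim (U₁ a) (U₂ a) s, fun bπ s => Sum.elim (V₁ bπ) (V₂ bπ) s, ?_, ?_, ?_⟩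
  · intro a s; rcases s with s | s
    · exact hU₁ a s
    · exact hU₂ a s
  · intro bπ s; rcases s with s | s
    · exact hV₁ bπ s
    · exact hV₂ bπ s
  · intro a b π
    rw [Fintype.sum_sum_type]
    simp only [Sum.elim_inl, Sum.elim_inr]
    rw [← h₁ a b π, ← h₂ a b π, ← add_mul]
    have hc : (cSmall b (posLT π a.card) : ℝ) + (cTwo b (posLT π a.card) : ℝ) = 1 := by
      exact_mod_cast cSmall_add_cTwo b (posLT π a.card)
    rw [hc, one_mul]

end BigClass

end Summit.ValiantsHypothesis.Theorems.NNDivisionHardNegative.WeakReliefBlind
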